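import Mathlib
import HarnessLib
import Literature.Combinatorics.SimpleGraph.Bramble
import Literature.Combinatorics.SimpleGraph.SubwalkBetween

/-!
# The Helly property of subtrees of a tree (Golumbic, Prop. 4.7; Bondy–Murty, Ex. 4.1.20)

Topic `Literature/Combinatorics/SimpleGraph`.  Twenty-first file of the chordal series.  A family of
sets has the HELLY PROPERTY if every pairwise-intersecting finite subfamily has a common element.
[Golumbic, *Algorithmic Graph Theory and Perfect Graphs*, Prop. 4.7]: **"A family of subtrees of a
tree satisfies the Helly property"** — the lemma behind the subtree (clique-tree) representation of
chordal graphs (Walter 1972, Gavril 1974, Buneman 1974; Golumbic Thm. 4.8) and behind the junction /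
running-intersection property of clique trees used by chordal SDP conversion
(`CliqueTree.TreeRunningIntersection.exists_meet`).  [Bondy–Murty, Ex. 4.1.20]: (a) for subtrees
`T₁, T₂` of a tree, `T₁ ∩ T₂` is a subtree iff it is nonempty; (b) the family of subtrees of a tree
has the Helly property.

Subtrees are modelled, as in `Bramble` (Diestel §12.4), by CONNECTED VERTEX SETS
`IsConnectedSet G X` (nonempty, any two vertices joined by a walk of `G` inside `X`; equivalently the
induced subgraph `G[X]` is connected, `isConnectedSet_iff`).  Only acyclicity of the ambient graph is
used (a forest will do); connectedness of the tree plays no role.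

## Contents

* `IsConnectedSet.inter_of_isAcyclic` [Bondy–Murty, Ex. 4.1.20 (a)] — in a forest, two connected
  vertex sets that meet have a connected intersection (paths in a forest are unique,
  `SimpleGraph.IsAcyclic.path_unique`).
* `IsAcyclic.exists_mem_inter_three` — THREE pairwise-meeting connected sets of a forest have a
  common vertex.  Proof (the "gate" argument): with `a ∈ X ∩ Y`, `b ∈ Y ∩ Z`, `c ∈ Z ∩ X`, walk from
  `a` to `b` inside `Y` and stop at the first vertex `y` of `Z`; walk from `a` to `c` inside `X` and
  stop at the first vertex `z` of `Z`; if `y ≠ z`, the first edge `y v` of a `y–z` path inside `Z`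
  is avoided by the closed detour `y → a → z → v`, contradicting that every edge of a forest is a
  bridge (`SimpleGraph.isAcyclic_iff_forall_isBridge`); so `y = z ∈ X ∩ Y ∩ Z`.
* **`IsAcyclic.helly_finset`** [Golumbic, Prop. 4.7; Bondy–Murty, Ex. 4.1.20 (b)] — a nonempty
  finite pairwise-meeting family of connected vertex sets of a forest has a common vertex, and the
  common part `⋂ S i` is itself a connected vertex set (induction on the family: replace two members
  by their intersection); corollaries **`IsAcyclic.helly`** (finite index type),
  **`IsTree.helly`** (trees), `IsTree.helly_induce_connected` (subtrees as connected induced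
  subgraphs).

## References

* [Golumbic1980] M. C. Golumbic, *Algorithmic Graph Theory and Perfect Graphs*, Academic Press
  (1980); 2nd ed. Ann. Discrete Math. 57 (2004), §4.5, Prop. 4.7 and Thm. 4.8.  Read: galaxy
  `panama:327388177104967`, chars 244800–248800 (Prop. 4.7 with proof).
* [BondyMurty2008] J. A. Bondy, U. S. R. Murty, *Graph Theory*, GTM 244 (2008), Ex. 1.3.7 (Helly
  property), Ex. 4.1.20 (a), (b).  Read: `book:bondy2008-graph-theory` p. 92 (PDF page).
* F. Gavril, *The intersection graphs of subtrees in trees are exactly the chordal graphs*,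
  J. Combin. Theory Ser. B 16 (1974) 47–56; P. Buneman, *A characterisation of rigid circuit
  graphs*, Discrete Math. 9 (1974) 205–212 (context only).
-/

namespace Literature.Combinatorics.SimpleGraph

open _root_.SimpleGraph

universe u

variable {V : Type u} {G : _root_.SimpleGraph V}

/-! ### Paths inside connected sets; intersections of subtrees -/

/-- Two vertices of a connected vertex set are joined by a PATH all of whose vertices lie in the
set (shorten any inside walk with `Walk.bypass`); private plumbing. [folklore] -/
private theorem IsConnectedSet.exists_isPath [DecidableEq V] {X : Set V} (hX : IsConnectedSet G X)
    {a b : V} (ha : a ∈ X) (hb : b ∈ X) :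
    ∃ p : G.Walk a b, p.IsPath ∧ ∀ z ∈ p.support, z ∈ X := by
  obtain ⟨W, hW⟩ := hX.2 ha hb
  exact ⟨W.bypass, W.bypass_isPath, fun z hz => hW z (W.support_bypass_subset_support hz)⟩

/-- **The intersection of two meeting subtrees of a forest is a subtree**: in an acyclic graph,
two connected vertex sets with a common vertex have a connected intersection — the unique path
between two common vertices lies in both sets. [cite: BondyMurty2008, Ex. 4.1.20 (a)] -/
theorem IsConnectedSet.inter_of_isAcyclic (hG : G.IsAcyclic) {X Y : Set V}
    (hX : IsConnectedSet G X) (hY : IsConnectedSet G Y) (hXY : (X ∩ Y).Nonempty) :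
    IsConnectedSet G (X ∩ Y) := by
  classical
  refine ⟨hXY, fun a ha b hb => ?_⟩
  obtain ⟨p, hp, hpX⟩ := hX.exists_isPath ha.1 hb.1
  obtain ⟨q, hq, hqY⟩ := hY.exists_isPath ha.2 hb.2
  have hpq : p = q := by
    have := hG.path_unique ⟨p, hp⟩ ⟨q, hq⟩
    simpa using congrArg Subtype.val this
  subst hpq
  exact ⟨p, fun z hz => ⟨hpX z hz, hqY z hz⟩⟩

/-! ### Three subtrees: the gate argument -/

/-- **Three pairwise-meeting subtrees of a forest have a common vertex.**  With `a ∈ X ∩ Y`,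
`b ∈ Y ∩ Z`, `c ∈ Z ∩ X`: the first `Z`-vertex `y` on a walk `a → b` inside `Y` and the first
`Z`-vertex `z` on a walk `a → c` inside `X` coincide (else the first edge of a `y–z` path inside `Z`
would not be a bridge), and this gate vertex lies in `X ∩ Y ∩ Z`.
[cite: Golumbic1980, Prop. 4.7 (three subtrees)] -/
theorem IsAcyclic.exists_mem_inter_three (hG : G.IsAcyclic) {X Y Z : Set V}
    (hX : IsConnectedSet G X) (hY : IsConnectedSet G Y) (hZ : IsConnectedSet G Z)
    (hXY : (X ∩ Y).Nonempty) (hYZ : (Y ∩ Z).Nonempty) (hZX : (Z ∩ X).Nonempty) :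
    (X ∩ Y ∩ Z).Nonempty := by
  classical
  obtain ⟨a, haX, haY⟩ := hXY
  obtain ⟨b, hbY, hbZ⟩ := hYZ
  obtain ⟨c, hcZ, hcX⟩ := hZX
  -- walk `a → b` inside `Y`, cut at its first visit `y` to `Z`
  obtain ⟨W₁, hW₁⟩ := hY.2 haY hbY
  obtain ⟨y, w₁, hyZ, -, hw₁s, hw₁Z⟩ := exists_subwalk_forall_imp_eq_end (· ∈ Z) W₁ hbZ
  -- walk `a → c` inside `X`, cut at its first visit `z` to `Z`
  obtain ⟨W₂, hW₂⟩ := hX.2 haX hcX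
  obtain ⟨z, w₂, hzZ, -, hw₂s, hw₂Z⟩ := exists_subwalk_forall_imp_eq_end (· ∈ Z) W₂ hcZ
  have hyY : y ∈ Y := hW₁ y (hw₁s y w₁.end_mem_support)
  have hzX : z ∈ X := hW₂ z (hw₂s z w₂.end_mem_support)
  by_cases hyz : y = z
  · subst hyz
    exact ⟨y, ⟨hzX, hyY⟩, hyZ⟩
  · exfalso
    obtain ⟨W₃, hW₃p, hW₃Z⟩ := hZ.exists_isPath hyZ hzZ
    cases W₃ with
    | nil => exact hyz rfl
    | cons h W₃' =>
      rename_i v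
      have hvZ : v ∈ Z := hW₃Z v (by
        rw [Walk.support_cons]
        exact List.mem_cons_of_mem _ W₃'.start_mem_support)
      have hyW₃' : y ∉ W₃'.support := ((Walk.cons_isPath_iff h W₃').1 hW₃p).2
      have hv₁ : v ∉ w₁.support := fun hv => h.ne (hw₁Z v hv hvZ).symm
      have hy₂ : y ∉ w₂.support := fun hy' => hyz (hw₂Z y hy' hyZ)
      have hbr : G.IsBridge s(y, v) :=
        isAcyclic_iff_forall_isBridge.1 hG ((mem_edgeSet G).2 h)
      rw [isBridge_iff_forall_walk_mem_edges] at hbr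
      have hω := hbr ((w₁.reverse.append w₂).append W₃'.reverse)
      simp only [Walk.edges_append, Walk.edges_reverse, List.mem_append, List.mem_reverse] at hω
      rcases hω with (h₁ | h₂) | h₃
      · exact hv₁ (w₁.snd_mem_support_of_mem_edges h₁)
      · exact hy₂ (w₂.fst_mem_support_of_mem_edges h₂)
      · exact hyW₃' (W₃'.fst_mem_support_of_mem_edges h₃)

/-! ### The Helly property -/

/-- **Helly property of subtrees of a forest, with the common part a subtree** (induction on the
family [Bondy–Murty, Ex. 4.1.20 (b)]): for a nonempty finite family `S i, i ∈ s` of connected vertex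
sets of an acyclic graph, pairwise meeting, the common part `⋂ i ∈ s, S i` is a connected vertex set
(in particular nonempty), and it meets every further connected vertex set meeting each member.
[cite: Golumbic1980, Prop. 4.7] [cite: BondyMurty2008, Ex. 4.1.20 (b)] -/
theorem IsAcyclic.isConnectedSet_biInter (hG : G.IsAcyclic) {ι : Type*} (S : ι → Set V)
    (s : Finset ι) (hs : s.Nonempty) (hconn : ∀ i ∈ s, IsConnectedSet G (S i))
    (h2 : ∀ i ∈ s, ∀ j ∈ s, (S i ∩ S j).Nonempty) :
    IsConnectedSet G (⋂ i ∈ s, S i) ∧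
      ∀ T : Set V, IsConnectedSet G T → (∀ i ∈ s, (T ∩ S i).Nonempty) →
        (T ∩ ⋂ i ∈ s, S i).Nonempty := by
  classical
  induction s using Finset.induction_on with
  | empty => exact absurd hs Finset.not_nonempty_empty
  | @insert k s hk ih =>
    rw [Finset.set_biInter_insert]
    by_cases hs0 : s = ∅
    · subst hs0
      simp only [Finset.notMem_empty, Set.iInter_of_empty, Set.iInter_univ, Set.inter_univ,
        IsEmpty.forall_iff, implies_true, Finset.mem_insert, or_false, forall_eq] at *
      exact ⟨hconn, fun T _ hT => hT⟩
    · have hs' : s.Nonempty := Finset.nonempty_iff_ne_empty.2 hs0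
      have hconn' : ∀ i ∈ s, IsConnectedSet G (S i) :=
        fun i hi => hconn i (Finset.mem_insert_of_mem hi)
      have h2' : ∀ i ∈ s, ∀ j ∈ s, (S i ∩ S j).Nonempty :=
        fun i hi j hj => h2 i (Finset.mem_insert_of_mem hi) j (Finset.mem_insert_of_mem hj)
      obtain ⟨hI, hmeet⟩ := ih hs' hconn' h2'
      have hk' : IsConnectedSet G (S k) := hconn k (Finset.mem_insert_self k s)
      have hkI : (S k ∩ ⋂ i ∈ s, S i).Nonempty :=
        hmeet (S k) hk' fun i hi => h2 k (Finset.mem_insert_self k s) i (Finset.mem_insert_of_mem hi)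
      refine ⟨hk'.inter_of_isAcyclic hG hI hkI, fun T hT hTS => ?_⟩
      have hTk : (T ∩ S k).Nonempty := hTS k (Finset.mem_insert_self k s)
      have hTI : (T ∩ ⋂ i ∈ s, S i).Nonempty :=
        hmeet T hT fun i hi => hTS i (Finset.mem_insert_of_mem hi)
      have h3 := IsAcyclic.exists_mem_inter_three hG hT hk' hI hTk hkI
        (by simpa only [Set.inter_comm] using hTI)
      simpa only [Set.inter_assoc] using h3

/-- **The Helly property of subtrees of a forest** (finite families indexed by a `Finset`): a
nonempty finite pairwise-meeting family of connected vertex sets of an acyclic graph has a common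
vertex. [cite: Golumbic1980, Prop. 4.7] [cite: BondyMurty2008, Ex. 4.1.20 (b)] -/
theorem IsAcyclic.helly_finset (hG : G.IsAcyclic) {ι : Type*} (S : ι → Set V) (s : Finset ι)
    (hs : s.Nonempty) (hconn : ∀ i ∈ s, IsConnectedSet G (S i))
    (h2 : ∀ i ∈ s, ∀ j ∈ s, (S i ∩ S j).Nonempty) : (⋂ i ∈ s, S i).Nonempty :=
  (IsAcyclic.isConnectedSet_biInter hG S s hs hconn h2).1.1

/-- **The Helly property of subtrees of a forest** (finite index type): finitely many connected
vertex sets of an acyclic graph, pairwise meeting, have a common vertex, and their common part is a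
connected vertex set. [cite: Golumbic1980, Prop. 4.7] -/
theorem IsAcyclic.helly (hG : G.IsAcyclic) {ι : Type*} [Finite ι] [Nonempty ι] (S : ι → Set V)
    (hconn : ∀ i, IsConnectedSet G (S i)) (h2 : ∀ i j, (S i ∩ S j).Nonempty) :
    IsConnectedSet G (⋂ i, S i) := by
  classical
  haveI := Fintype.ofFinite ι
  have h := (IsAcyclic.isConnectedSet_biInter hG S Finset.univ Finset.univ_nonempty
    (fun i _ => hconn i) (fun i _ j _ => h2 i j)).1
  have e : (⋂ i ∈ (Finset.univ : Finset ι), S i) = ⋂ i, S i := by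
    ext x
    simp
  rwa [e] at h

/-- **"A family of subtrees of a tree satisfies the Helly property"** [Golumbic, Prop. 4.7]:
finitely many pairwise-meeting connected vertex sets of a tree have a common vertex.
[cite: Golumbic1980, Prop. 4.7] [cite: BondyMurty2008, Ex. 4.1.20 (b)] -/
theorem IsTree.helly (hG : G.IsTree) {ι : Type*} [Finite ι] [Nonempty ι] (S : ι → Set V)
    (hconn : ∀ i, IsConnectedSet G (S i)) (h2 : ∀ i j, (S i ∩ S j).Nonempty) :
    (⋂ i, S i).Nonempty :=
  (IsAcyclic.helly hG.isAcyclic S hconn h2).1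

/-- The Helly property for SUBTREES AS CONNECTED INDUCED SUBGRAPHS: finitely many vertex sets of a
tree, each inducing a connected subgraph, pairwise meeting, have a common vertex.
[cite: Golumbic1980, Prop. 4.7] -/
theorem IsTree.helly_induce_connected (hG : G.IsTree) {ι : Type*} [Finite ι] [Nonempty ι]
    (S : ι → Set V) (hconn : ∀ i, (G.induce (S i)).Connected)
    (h2 : ∀ i j, (S i ∩ S j).Nonempty) : (⋂ i, S i).Nonempty :=
  IsTree.helly hG S (fun i => isConnectedSet_iff.2 (hconn i)) h2

end Literature.Combinatorics.SimpleGraph
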